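import Summits.CriticalPhenomena.CardyFormulaZ2.Theses.CardyMeckeFlip
import Literature.Probability.Percolation.FlipFairKernel
import Literature.Probability.Percolation.Z2PivotalMeasure
import Summits.CriticalPhenomena.CardyFormulaZ2.Theorems.CardyMeckeFlipFlipErgodicityZ2StubFlipExtremalOfTrivialDensity
import HarnessLib

/-!
# Crux `FlipErgodicityZ2` (stmt-CriticalPhenomena-14825) — the K1-pinned three-piece split and its glue

Route `Summits/CriticalPhenomena/CardyFormulaZ2/Theses/CardyMeckeFlip`, crux `FlipErgodicityZ2`
(K3, rank 3): `∀ μ ∈ Λ, ∃ M, (ADM) ∧ (F) ∧ (EXT)` over a characterised pivotal predicate.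
Crux-strategist seat `planner-cstrat-stmt-CriticalPhenomena-14825-s2-0` (2026-08-17), following the
unanimous recommendation of the three line leads (`Cruxes/FlipErgodicityZ2/Lines/birth-lead-c1/c2/c3.md`:
"file `PivotalKernelErgodic` as an item; line K1 on the kernel stubs").

The typed split `FlipErgodicityZ2 ⇐ CanonicalKernelZ2 → CanonicalKernelFlipFairZ2 → PivotalKernelErgodicZ2`:

* `CanonicalKernelZ2` — every `μ ∈ Λ = subseqQuadLimits univ` carries THE canonical
  Garban–Pete–Schramm kernel: a joint subsequential limit `M` of the isometry-averaged normalised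
  `ε`-important counting measures of bond-`ℤ²` (`IsZ2PivotalKernelLimit μ M`) with an admissible,
  isometry-equivariant version (GPS 2013 Thm 1.1/4.3 for `ℤ²`, unprinted; equivariance needs rotation
  invariance of `μ`, DKKMO 2020) — the conclusion of the registered `stub_kernelExistsZ2_of_lattice`;
* `CanonicalKernelFlipFairZ2` — every admissible pivotal-kernel limit is flip-fair for `μ` at every
  cutoff (GPS 2018 §11.1 in Campbell–Mecke form for `ℤ²`; the conclusion of the registered
  `stub_flipPassesToLimit_of_glue`, closed modulo node (C));
* `PivotalKernelErgodicZ2` — VERBATIM the registered open stub `stub_pivotalKernelErgodic` (density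
  form of (EXT) for the canonical kernel; GPS 2018 §12.1's open question for `ℤ²` sublimits; on `𝕋`
  GHSS 2021 Thm 1.4(i)).

`flipErgodicityZ2_of_subs : CanonicalKernelZ2 → CanonicalKernelFlipFairZ2 → PivotalKernelErgodicZ2 →
FlipErgodicityZ2` (hypotheses = the three statements verbatim, conclusion = the route decl BY NAME) is
the glue for `ledger route edit route-CriticalPhenomena-CardyMeckeFlip --split FlipErgodicityZ2 --into …
--glue-by`; it is the tail of the registered composition `FlipErgodicityZ2_of` of `Lines/birth.lean`:
the characterised parameter is `QuadConfig.IsPivotalAt` (`QuadConfig.eq_isPivotalAt_of_forall_iff`),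
density triviality gives (EXT) by the landed stub 4 (`stub_flipExtremal_of_trivialDensity`, p143383),
and the named clauses unfold to the crux's inlined text by `Iff.rfl`
(`isAdmissibleKernel_and_isIsometryEquivariant_iff`, `isFlipFairKernel_iff`, `isFlipExtremal_iff`).

No `def`s; unconditional; standard axioms; no named facts.
-/

open MeasureTheory Set Filter Topology Metric
open Literature.Probability.Percolation Literature.Probability.Percolation.QuadCrossing

namespace Summit.CriticalPhenomena.CardyFormulaZ2.Theorems.CardyMeckeFlip

/-- **Glue of the K1-pinned split of `FlipErgodicityZ2`.**  If (i) every subsequential quad-crossing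
limit of bond-`ℤ²` carries a canonical pivotal-kernel limit with an admissible isometry-equivariant
version, (ii) every admissible pivotal-kernel limit is flip-fair at every cutoff, and (iii) for such a
kernel every bounded flip-fair density is trivial, then the crux `FlipErgodicityZ2` holds.  Shape
`C₁ → C₂ → C₃ → C` for `ledger route edit --split FlipErgodicityZ2 --glue-by`. [folklore] -/
theorem flipErgodicityZ2_of_subs :
    (∀ μ : FiniteMeasure (QuadConfig (Set.univ : Set ℂ)), μ ∈ subseqQuadLimits (Set.univ : Set ℂ) →
      ∃ M : ℝ → QuadConfig (Set.univ : Set ℂ) → Measure ℂ,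
        IsZ2PivotalKernelLimit μ M ∧
          IsAdmissibleKernel (μ : Measure (QuadConfig (Set.univ : Set ℂ))) M ∧
            IsIsometryEquivariant M) →
    (∀ (μ : FiniteMeasure (QuadConfig (Set.univ : Set ℂ)))
      (M : ℝ → QuadConfig (Set.univ : Set ℂ) → Measure ℂ),
      IsZ2PivotalKernelLimit μ M →
        IsAdmissibleKernel (μ : Measure (QuadConfig (Set.univ : Set ℂ))) M →
          ∀ ε : ℝ, 0 < ε → IsFlipFairKernel (μ : Measure (QuadConfig (Set.univ : Set ℂ))) (M ε)) →
    (∀ (μ : FiniteMeasure (QuadConfig (Set.univ : Set ℂ)))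
      (M : ℝ → QuadConfig (Set.univ : Set ℂ) → Measure ℂ),
      IsZ2PivotalKernelLimit μ M →
        IsAdmissibleKernel (μ : Measure (QuadConfig (Set.univ : Set ℂ))) M →
          IsIsometryEquivariant M →
            (∀ ε : ℝ, 0 < ε →
              IsFlipFairKernel (μ : Measure (QuadConfig (Set.univ : Set ℂ))) (M ε)) →
              ∀ f : QuadConfig (Set.univ : Set ℂ) → ENNReal, Measurable f → (∀ S, f S ≤ 2) →
                IsProbabilityMeasure
                    ((μ : Measure (QuadConfig (Set.univ : Set ℂ))).withDensity f) →
                  (∀ ε : ℝ, 0 < ε →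
                    IsFlipFairKernel
                      ((μ : Measure (QuadConfig (Set.univ : Set ℂ))).withDensity f) (M ε)) →
                    (μ : Measure (QuadConfig (Set.univ : Set ℂ))).withDensity f =
                      (μ : Measure (QuadConfig (Set.univ : Set ℂ)))) →
    Summit.CriticalPhenomena.CardyFormulaZ2.Theses.CardyMeckeFlip.FlipErgodicityZ2 := by
  intro hK hF hErg Piv hPiv μ hμ
  -- the characterised parameter IS the named pivotal predicate
  obtain rfl : Piv = fun S x Q => QuadConfig.IsPivotalAt S x Q :=
    QuadConfig.eq_isPivotalAt_of_forall_iff hPiv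
  -- (i) the canonical kernel, admissible and equivariant
  obtain ⟨M, hlim, hadm, hequiv⟩ := hK μ hμ
  -- (ii) flip-fairness at every cutoff
  have hff : ∀ ε : ℝ, 0 < ε →
      IsFlipFairKernel (μ : Measure (QuadConfig (Set.univ : Set ℂ))) (M ε) := hF μ M hlim hadm
  -- (iii) density triviality, hence (EXT) by the landed stub 4
  have hext : IsFlipExtremal (μ : Measure (QuadConfig (Set.univ : Set ℂ))) M :=
    stub_flipExtremal_of_trivialDensity _ M (hErg μ M hlim hadm hequiv hff)
  -- unfold the named clauses to the crux's inlined text (all `Iff.rfl`)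
  refine ⟨M, (isAdmissibleKernel_and_isIsometryEquivariant_iff _ M).1 ⟨hadm, hequiv⟩, ?_, ?_⟩
  · intro ε hε
    exact (isFlipFairKernel_iff _ _).1 (hff ε hε)
  · exact (isFlipExtremal_iff _ M).1 hext

end Summit.CriticalPhenomena.CardyFormulaZ2.Theorems.CardyMeckeFlip
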